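import Summits.QuantumFields.YangMills.Theorems.BalabanUVNodesN10OlderTermsBanachSectionAtTableGerms
import Literature.MathematicalPhysics.QuantumFieldTheory.Balaban1983to89.B13TermDatum214ParamHolo

/-!
# BalabanUVNodes ∕ N10 ([B13], NODE A) → N22 (NE9): THE LEVEL-T BLOCK's `h226` AT THE TABLE-GERM SECTION FROM ONE LOCATED (2.26) RECORD — the (2.14) term of
# def-W1's datum, read along the canonical Banach section of the older-term table, is HOLOMORPHIC with the (2.26) WEIGHT on the ball, from this lane's
# `B13TermDatum214ParamHolo.h226T_of_inputs226Holo` (module 37) FED BY module 106's three history letters (module 107)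

Track A of `YM-PLAN.md` (cell `pub-ymgap`, HUMAN RULING D-0062), seat `pub-ymgap-dag-n10-c` g19, DAG edge **N10 → N22**, module 107 (capstone of 104–106 with module 37).
THEOREMS ONLY (0 `def`, 0 `sorry`, standard axioms); `--supports stmt-QuantumFields-27364 --as helper`; COUNT-NEUTRAL.  IR-N22-AR precision #2∕#3 (dag-n22-c ∕ dag-lead
DEDUP-408): the producer-facing input of the N22 lane's activity-level junction (J66∕J67 §2) is the LEVEL-T block `Tt hdom h226` — `Tt` = def-W1's display (2.14) read along
the section, `hdom` = def-W1's `TermData214.norm_H_Gn_le`, and **`h226` = THIS FILE**.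

WHAT.  ★★★ `termReading226_tableGerms_of_inputs226Holo` — for a (2.14) term datum `𝔇 : TermDatum214 c₀ P 𝔸 M k L` under def-W1's storey-11 law `UnscaledFieldLawOn` and
storey-17 law `ReadsBy 𝒪 R` (atoms in the tables for the window, continuous ∕ jointly continuous configuration families, bounded kernels, finite masses), the Wilson part
measurable in the field, at a window coupling `s ∈ ]0, γ]` and `φ` in the window: ONE located (2.26) record `ι : 𝔇.Inputs226Holo c Z t s old₀ φ a a₅` (NODE A's kernel letters,
(2.22), numerics — this lane's standing displayed class) at an ADMISSIBLE history `old₀ ∈ W1.AdmHist sp E₀ r₁ k`, a bounded τ-region (`Σ_Y ‖τ Y‖ ≤ τ_Σ` on `Π ι.Uτ`), and (2.20)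
at `old₀` WITH A MARGIN (`… ≤ ½ι.a₂₀(B·B) + w₀`, `w₀ + τ_Σ·(Σ_jΣ_X C)·m·(E₀ + b⁻¹R_p) ≤ ι.w`) ⟹ along the table-germ section `cv κ bw` of module 105 (`0 ≤ κ`, level weights
`0 < b ≤ bw j`): **`p ↦ 𝔇.TF Z t s (cv p) φ` is complex differentiable on `ball 0 R_p` and `‖𝔇.TF Z t s (cv p) φ‖ ≤ weight L M c Z a t·e^{a₅|Z|}` there** — module 37 with
`hVm ∕ hVd ∕ h220W` := module 106's `measurable_𝒱_tableGerms` ∕ `differentiableOn_𝒱_tableGerms` ∕ `sum_norm_𝒱_tableGerms_le_of_record220`.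
HONEST FRAMING (binding).  Kernel composition; the record `ι`, def-W1's laws + atom laws, (2.20) at `old₀` with its margin, the τ-region's size and `𝒲`'s measurability are
DISPLAYED; nothing of Bałaban's ((2.20), (2.22), (2.26), Lemma 2) is proved or asserted; N10 ∕ N22 NOT discharged; counts UNMOVED (5∕27); nothing continuum ∕ ℝ⁴ ∕ OS ∕
mass-gap ∕ Clay.
-/

noncomputable section

open Set Metric MeasureTheory
open scoped BigOperators Matrix

namespace YMDAG.N10

open Literature.MathematicalPhysics.QuantumFieldTheory.Balaban1983to89
open Literature.MathematicalPhysics.QuantumFieldTheory.Balaban1983to89.TreeLengthTorus (TDom)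
open Literature.MathematicalPhysics.QuantumFieldTheory.Balaban1983to89.B13Lemma3TorusTerms (weight)
open Literature.MathematicalPhysics.QuantumFieldTheory.Balaban1983to89.Node00
open Literature.MathematicalPhysics.QuantumFieldTheory.Balaban1983to89.Node00.Sect2 (domSys domCount CPair)
open Literature.MathematicalPhysics.QuantumFieldTheory.Balaban1983to89.Node00.W1
open Literature.MathematicalPhysics.QuantumFieldTheory.Balaban1983to89.B13OlderTermsTableGerms (Pot cv)
open Literature.MathematicalPhysics.QuantumFieldTheory.Balaban1983to89.B13TermDatum214ParamHolo (h226T_of_inputs226Holo)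

variable {c₀ : B13.Consts} {P : Params} {𝔸 : Type} [NormedRing 𝔸] [NormedAlgebra ℂ 𝔸] {M k L : ℕ} [NeZero L]
  (𝔇 : TermDatum214 c₀ P 𝔸 M k L) {S : Type} [MeasurableSpace S] [TopologicalSpace S] [OpensMeasurableSpace S]
  (sp : (j : ℕ) → (domSys P M j).Dom → Set (CPair P 𝔸)) (κ : ℝ) (bw : Fin (k + 1) → ℝ)
  {χu χcu : 𝔇.UnscaledChi} {𝒲 : 𝔇.UnscaledWilson} {𝒪 : 𝔇.UnscaledOlder} {γ : ℝ}
  (R : (Z : (domSys P M (k + 1)).Dom) → (t : TermLabel P M k L) → 𝔇.ReadingAtoms Z t S)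
  (W : (Z : (domSys P M (k + 1)).Dom) → TermLabel P M k L → Set (CPair P 𝔸)) {C m b E₀ r₁ : ℝ}

/-- ★★★ **THE (2.14) TERM OF THE DATUM READ ALONG THE TABLE-GERM SECTION IS HOLOMORPHIC WITH THE (2.26) WEIGHT ON THE BALL, FROM ONE LOCATED (2.26) RECORD AT AN
ADMISSIBLE HISTORY** — module 37's `h226T_of_inputs226Holo` with its three history letters along the section supplied by module 106 (`hVm` ∕ `hVd` from def-W1's laws,
`h220W` from the record's (2.20) at `old₀` with the margin `w₀ + τ_Σ·(Σ_jΣ_X C)·m·(E₀ + b⁻¹R_p) ≤ ι.w`).  The `h226` input of the N22 lane's activity-level junction, per term.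
[folklore] -/
theorem termReading226_tableGerms_of_inputs226Holo (hlaw : 𝔇.UnscaledFieldLawOn χu χcu 𝒲 𝒪 γ) (hread : 𝔇.ReadsBy 𝒪 R)
    (hmaps : ∀ Z t, (R Z t).MapsToTables sp (W Z t) univ) (hcont : ∀ Z t, (R Z t).CfgContinuous) (hjc : ∀ Z t, (R Z t).CfgJointContinuous)
    (hK : ∀ Z t, (R Z t).KernelBounded C) (hμ : ∀ Z t, (R Z t).FiniteMass m) (hC : 0 ≤ C) (hm : 0 ≤ m) (hκ : 0 ≤ κ) (hb : 0 < b) (hbw : ∀ j, b ≤ bw j)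
    (hE₀ : 0 ≤ E₀) (hr₁ : 0 ≤ r₁)
    (hWm : ∀ (Z : (domSys P M (k + 1)).Dom) (t : TermLabel P M k L) (φ : CPair P 𝔸) (Y : TDom P.d (L * domCount P M (k + 1))),
      Measurable fun B : (𝔇.𝒦 Z t).Λ → ℝ => 𝒲 Z t φ Y B)
    {c : B13.Consts} (hκ₁ : 1 ≤ c.κ₁) (hα₆ : c.α₆ ≠ 0)
    {Z : (domSys P M (k + 1)).Dom} {t : TermLabel P M k L} {s : ℝ} (hs : s ∈ Ioc (0 : ℝ) γ) {φ : CPair P 𝔸} (hφ : φ ∈ W Z t)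
    {old₀ : OlderTerms P 𝔸 M k} (hold₀ : old₀ ∈ AdmHist sp E₀ r₁ k) {a a₅ : ℝ} (ι : 𝔇.Inputs226Holo c Z t ((s : ℝ) : ℂ) old₀ φ a a₅)
    {τs w₀ Rp : ℝ} (hRp : 0 ≤ Rp)
    (hτ : ∀ τ : TDom P.d (L * domCount P M (k + 1)) → ℂ, (∀ Y, τ Y ∈ ι.Uτ Y) → ∑ Y ∈ t.1, ‖τ Y‖ ≤ τs)
    (h220₀ : ∀ τ : TDom P.d (L * domCount P M (k + 1)) → ℂ, (∀ Y, τ Y ∈ ι.Uτ Y) → ∀ B : (𝔇.𝒦 Z t).Λ → ℝ,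
      ∑ Y ∈ t.1, ‖τ Y‖ * ‖𝔇.𝒱 Z t ((s : ℝ) : ℂ) old₀ φ Y B‖ ≤ ι.a₂₀ / 2 * (B ⬝ᵥ B) + w₀)
    (hw : w₀ + τs * ((∑ _j : Fin (k + 1), ∑ _X : (domSys P M _j).Dom, C) * m * (E₀ + b⁻¹ * Rp)) ≤ ι.w) :
    DifferentiableOn ℂ (fun p : Pot k sp => 𝔇.TF Z t ((s : ℝ) : ℂ) (cv κ bw p) φ) (ball 0 Rp) ∧
      ∀ p ∈ ball (0 : Pot k sp) Rp, ‖𝔇.TF Z t ((s : ℝ) : ℂ) (cv κ bw p) φ‖ ≤ weight L M c Z a t * Real.exp (a₅ * ((Z.1).card : ℝ)) :=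
  h226T_of_inputs226Holo 𝔇 hκ₁ hα₆ ι isOpen_ball (cv (k := k) (sp := sp) κ bw)
    (fun p _ Y => measurable_𝒱_tableGerms 𝔇 sp κ bw R W hlaw hread hmaps hjc hK hμ hκ hb hbw hWm hs hφ p Y)
    (fun Y B => differentiableOn_𝒱_tableGerms 𝔇 sp κ bw R W hlaw hread hmaps hcont hK hμ hC hm hκ hb hbw hs hφ Y B (ball 0 Rp))
    (fun p hp τ hτU B =>
      (sum_norm_𝒱_tableGerms_le_of_record220 𝔇 sp κ bw R W hlaw hread hmaps hK hμ hC hm hκ hb hbw hE₀ hr₁ hs hφ hold₀ hRp hτ h220₀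
        (le_of_lt (mem_ball_zero_iff.1 hp)) τ hτU B).trans (by linarith))

/-! ## §2 (v1.1)  The same block WITHOUT the τ-region-size hypothesis: the size is a letter of the record (module 37 v1.1 §4) -/

/-- ★★★ **(v1.1) THE LEVEL-T `h226` FROM ONE LOCATED RECORD, THE τ-REGION SIZE READ OFF THE RECORD.**  As `termReading226_tableGerms_of_inputs226Holo`,
but the binder `hτ : Σ_{Y ∈ 𝐃(t)} ‖τ Y‖ ≤ τ_Σ on Π_Y ι.Uτ Y` (and the letter `τ_Σ`) is GONE: by module 37 v1.1 §4 `exists_inputs226Holo_tauBounded` the record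
restricts, with the same letters `a₂₀, w`, to τ-regions inside the discs `|τ| < r̂(Y) + r + 2` (`r̂(Y) = (invTau c d(Y))⁻¹` print's τ-radius (2.18), `r` the
datum's Cauchy radius), so the margin is stated with the EXPLICIT size `τ_Σ(ι) := Σ_{Y ∈ 𝐃(t)} (r̂(Y) + r + 2)`:
`w₀ + τ_Σ(ι)·(Σ_jΣ_X C)·m·(E₀ + b⁻¹R_p) ≤ ι.w`, and (2.20) at `old₀` with slack `w₀` is asked on the record's own region `Π_Y ι.Uτ Y` as before.
One displayed row fewer per term for the N22 junction of record (dag-n22-c J69 `…TermDataTableGermsLocated` §1 binder `hι`: the `∃ τs` conjunct).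
HONEST FRAMING: kernel composition (module 37 v1.1 §4 ∘ §1 of this file); the record `ι`, the laws, (2.20) at `old₀` with its margin and `𝒲`'s
measurability stay DISPLAYED; nothing of Bałaban's proved; N10 ∕ N22 NOT discharged. [folklore] -/
theorem termReading226_tableGerms_of_inputs226Holo_tauRadii (hlaw : 𝔇.UnscaledFieldLawOn χu χcu 𝒲 𝒪 γ) (hread : 𝔇.ReadsBy 𝒪 R)
    (hmaps : ∀ Z t, (R Z t).MapsToTables sp (W Z t) univ) (hcont : ∀ Z t, (R Z t).CfgContinuous) (hjc : ∀ Z t, (R Z t).CfgJointContinuous)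
    (hK : ∀ Z t, (R Z t).KernelBounded C) (hμ : ∀ Z t, (R Z t).FiniteMass m) (hC : 0 ≤ C) (hm : 0 ≤ m) (hκ : 0 ≤ κ) (hb : 0 < b) (hbw : ∀ j, b ≤ bw j)
    (hE₀ : 0 ≤ E₀) (hr₁ : 0 ≤ r₁)
    (hWm : ∀ (Z : (domSys P M (k + 1)).Dom) (t : TermLabel P M k L) (φ : CPair P 𝔸) (Y : TDom P.d (L * domCount P M (k + 1))),
      Measurable fun B : (𝔇.𝒦 Z t).Λ → ℝ => 𝒲 Z t φ Y B)
    {c : B13.Consts} (hκ₁ : 1 ≤ c.κ₁) (hα₆ : c.α₆ ≠ 0)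
    {Z : (domSys P M (k + 1)).Dom} {t : TermLabel P M k L} {s : ℝ} (hs : s ∈ Ioc (0 : ℝ) γ) {φ : CPair P 𝔸} (hφ : φ ∈ W Z t)
    {old₀ : OlderTerms P 𝔸 M k} (hold₀ : old₀ ∈ AdmHist sp E₀ r₁ k) {a a₅ : ℝ} (ι : 𝔇.Inputs226Holo c Z t ((s : ℝ) : ℂ) old₀ φ a a₅)
    {w₀ Rp : ℝ} (hRp : 0 ≤ Rp)
    (h220₀ : ∀ τ : TDom P.d (L * domCount P M (k + 1)) → ℂ, (∀ Y, τ Y ∈ ι.Uτ Y) → ∀ B : (𝔇.𝒦 Z t).Λ → ℝ,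
      ∑ Y ∈ t.1, ‖τ Y‖ * ‖𝔇.𝒱 Z t ((s : ℝ) : ℂ) old₀ φ Y B‖ ≤ ι.a₂₀ / 2 * (B ⬝ᵥ B) + w₀)
    (hw : w₀ + (∑ Y ∈ t.1, ((B13Bound143.invTau c ((TreeLengthTorus.tsys P.d (L * domCount P M (k + 1))).dj Y))⁻¹ + 𝔇.r + 2)) *
        ((∑ _j : Fin (k + 1), ∑ _X : (domSys P M _j).Dom, C) * m * (E₀ + b⁻¹ * Rp)) ≤ ι.w) :
    DifferentiableOn ℂ (fun p : Pot k sp => 𝔇.TF Z t ((s : ℝ) : ℂ) (cv κ bw p) φ) (ball 0 Rp) ∧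
      ∀ p ∈ ball (0 : Pot k sp) Rp, ‖𝔇.TF Z t ((s : ℝ) : ℂ) (cv κ bw p) φ‖ ≤ weight L M c Z a t * Real.exp (a₅ * ((Z.1).card : ℝ)) := by
  obtain ⟨ι', hsub, ha, hw', hτ'⟩ := B13TermDatum214ParamHolo.exists_inputs226Holo_tauBounded 𝔇 ι
  refine termReading226_tableGerms_of_inputs226Holo (w₀ := w₀) 𝔇 sp κ bw R W hlaw hread hmaps hcont hjc hK hμ hC hm hκ hb hbw hE₀ hr₁ hWm hκ₁ hα₆ hs hφ
    hold₀ ι' hRp hτ' (fun τ hτ B => ?_) ?_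
  · rw [ha]; exact h220₀ τ (fun Y => hsub Y (hτ Y)) B
  · rw [hw']; exact hw

end YMDAG.N10

end
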